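import Summits.Ventures.PackingBounds.Energy.NewtonCertificate
import Summits.Ventures.PackingBounds.Energy.CrossPolytopeUniversal

/-!
# Universal optimality of the regular cross-polytope (`2n` points on `S^{n-1}`, every `n ≥ 3`) —
Cohn–Kumar 2007, Thm. 1.2, in LP-certificate form

Framing: lottery ticket; floor = certified bounds/negative ranges. Venture `PackingBounds` (cell
`pub-packcert`, seat `pub-packcert-energy`), energy-minimisation family, **universal + control**
(all dimensions `n ≥ 3`, all potentials of the class at once).

**Theorem A (`ckPow_energy_ge`).** For every `n ≥ 3`, every `k : ℕ` and every configuration `C` of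
`2n` unit vectors of `ℝⁿ`: `Σ_{x ≠ y ∈ C} (1 + ⟨x,y⟩)^k ≥ 2n · ((1 + (-1))^k + (2n - 2)(1 + 0)^k)`, the
`(1+t)^k`-energy of the regular cross-polytope `{±e_1, …, ±e_n}` (one antipode and `2n - 2`
orthogonal neighbours per vertex; a spherical `3`-design).

**Theorem B (`universally_optimal`).** For every potential `a` represented on `[-1,1)` by
`a(s) = Σ_k c_k (1+s)^k` with `c_k ≥ 0` (≡ absolutely monotonic on `[-1,1)`, S. Bernstein; e.g. all
inverse power laws `|x-y|^{-s}`), every such `C` has `Σ_{x ≠ y ∈ C} a(⟨x,y⟩) ≥ 2n (a(-1) + (2n-2) a(0))`,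
the `a`-energy of the cross-polytope. This makes the tree's `crossPolytope_energy_ge`
(`CrossPolytopeUniversal.lean`, where the quadratic Hermite minorant was a hypothesis) unconditional
for the power-series class.

Certificate (symbolic in `μ = n/2 - 1 > 0`): node values `u = 1 + t ∈ (0, 1)` doubled, `D = 4`;
Gegenbauer table of the Newton partial products `1, u, u(u-1), u²(u-1)`:
`u = C_0 + C_1/(2μ)`, `u(u-1) = 1/(2(μ+1)) C_0 + C_1/(2μ) + C_2/(2μ(μ+1))`,
`u²(u-1) = 1/(μ+1) C_0 + (1/(2μ) + 3/(4μ(μ+2))) C_1 + C_2/(μ(μ+1)) + 3 C_3/(4μ(μ+1)(μ+2))` — all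
coefficients `≥ 0` (Cohn–Kumar conductivity) — and the four design identities of the distance
distribution `(1, 2n-2)` at `u = (0, 1)`; then `NewtonCert.energy_ge` / `energy_ge_hasSum_of_pow`.

## References
* H. Cohn, A. Kumar, *Universally optimal distribution of points on spheres*, J. Amer. Math. Soc.
  20 (2007) 99–148, Thm. 1.2, Table 1, Prop. 4.1, §§5–6. [`CohnKumar2006`]
-/

noncomputable section

namespace Summit.Ventures.PackingBounds.Energy

open Finset Literature.Analysis.SpecialFunctions Literature.Geometry.DiscreteGeometry

namespace UniversalCrossPolytope

/-- `C_3^{(μ)}(t) = (4/3) μ (μ+1) (μ+2) t³ - 2 μ (μ+1) t` for the explicit Gegenbauer sum of the tree.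
[folklore] -/
theorem gegenbauerSum_three (μ t : ℝ) :
    gegenbauerSum μ 3 t = 4 / 3 * μ * (μ + 1) * (μ + 2) * t ^ 3 - 2 * μ * (μ + 1) * t := by
  simp [gegenbauerSum, gegenbauerCoeff, Finset.sum_range_succ, Finset.prod_range_succ,
    Nat.factorial]
  ring

open scoped Classical in
/-- **Theorem A.** For `n ≥ 3` and every `k`, every `2n`-point configuration of unit vectors in `ℝⁿ`
has `Σ_{x ≠ y} (1 + ⟨x,y⟩)^k ≥ 2n ((1 + (-1))^k + (2n-2) (1 + 0)^k)`, the value of the regular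
cross-polytope. Newton-form certificate, symbolic in `μ = n/2 - 1`.
[cite: CohnKumar2006, Theorem 1.2, Table 1 and §6] -/
theorem ckPow_energy_ge {n : ℕ} (hn : 3 ≤ n) (k : ℕ) (C : Finset (EuclideanSpace ℝ (Fin n)))
    (h1 : ∀ x ∈ C, ‖x‖ = 1) (hN : C.card = 2 * n) :
    (2 * n : ℝ) * ((1 + (-1 : ℝ)) ^ k + (2 * n - 2) * (1 + (0 : ℝ)) ^ k) ≤
      ∑ x ∈ C, ∑ y ∈ C.erase x, (1 + inner ℝ x y) ^ k := by
  have hn3 : (3 : ℝ) ≤ n := by exact_mod_cast hn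
  obtain ⟨μ, hμ, hnμ⟩ : ∃ μ : ℝ, 0 < μ ∧ (n : ℝ) = 2 * μ + 2 :=
    ⟨((n : ℝ) - 2) / 2, by linarith, by ring⟩
  have hμ0 : μ ≠ 0 := hμ.ne'
  have hμ1 : μ + 1 ≠ 0 := by positivity
  have hμ2 : μ + 2 ≠ 0 := by positivity
  refine le_trans (le_of_eq ?val) (NewtonCert.energy_ge (n := n) (μ := μ) hnμ hμ 4 (by norm_num)
    -- node values u_i = 1 + t_i: antipode u = 0, orthogonal u = 1 (doubled)
    (fun i : ℕ => match i with | 0 => (0 : ℝ) | 1 => 1 | 2 => 0 | 3 => 1 | _ => 0)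
    ?hv ?hsq
    -- Gegenbauer C^(μ) table of the Newton partial products 1, u, u(u-1), u²(u-1)
    (fun j i : ℕ => match j with
      | 0 => (match i with | 0 => (1 : ℝ) | _ => 0)
      | 1 => (match i with | 0 => (1 : ℝ) | 1 => 1 / (2 * μ) | _ => 0)
      | 2 => (match i with
          | 0 => (1 / (2 * (μ + 1)) : ℝ) | 1 => 1 / (2 * μ) | 2 => 1 / (2 * μ * (μ + 1)) | _ => 0)
      | 3 => (match i with
          | 0 => (1 / (μ + 1) : ℝ) | 1 => 1 / (2 * μ) + 3 / (4 * μ * (μ + 2))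
          | 2 => 1 / (μ * (μ + 1)) | 3 => 3 / (4 * μ * (μ + 1) * (μ + 2)) | _ => 0)
      | _ => 0)
    ?hG ?hGid (2 * n) 2 (by norm_num)
    -- distance distribution: 1 antipode, 2n - 2 orthogonal neighbours
    (fun i : ℕ => match i with | 0 => (1 : ℝ) | 1 => 2 * n - 2 | _ => 0)
    ?hdes k C h1 hN)
  case hv => intro i; split <;> norm_num
  case hsq =>
    exact fun u _ => NewtonCert.omega_doubled_nonneg _ 2 (fun i hi => by
      interval_cases i <;> norm_num) u
  case hG =>
    intro j i
    split <;> (first | (split <;> positivity) | norm_num)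
  case hGid =>
    intro j hj t
    interval_cases j
    · simp only [Finset.prod_range_zero, Finset.sum_range_succ, Finset.sum_range_zero,
        gegenbauerSum_zero, gegenbauerSum_one, gegenbauerSum_two, gegenbauerSum_three]
      ring
    · simp only [Finset.prod_range_succ, Finset.prod_range_zero, Finset.sum_range_succ,
        Finset.sum_range_zero, gegenbauerSum_zero, gegenbauerSum_one, gegenbauerSum_two,
        gegenbauerSum_three]
      field_simp
      ring
    · simp only [Finset.prod_range_succ, Finset.prod_range_zero, Finset.sum_range_succ,
        Finset.sum_range_zero, gegenbauerSum_zero, gegenbauerSum_one, gegenbauerSum_two,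
        gegenbauerSum_three]
      field_simp
      ring
    · simp only [Finset.prod_range_succ, Finset.prod_range_zero, Finset.sum_range_succ,
        Finset.sum_range_zero, gegenbauerSum_zero, gegenbauerSum_one, gegenbauerSum_two,
        gegenbauerSum_three]
      field_simp
      ring
  case hdes =>
    intro j hj
    interval_cases j
    · simp only [Finset.prod_range_zero, Finset.sum_range_succ, Finset.sum_range_zero]
      push_cast
      ring
    · simp only [Finset.prod_range_succ, Finset.prod_range_zero, Finset.sum_range_succ,
        Finset.sum_range_zero]
      push_cast
      ring
    · simp only [Finset.prod_range_succ, Finset.prod_range_zero, Finset.sum_range_succ,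
        Finset.sum_range_zero]
      push_cast
      rw [hnμ]
      field_simp
      ring
    · simp only [Finset.prod_range_succ, Finset.prod_range_zero, Finset.sum_range_succ,
        Finset.sum_range_zero]
      push_cast
      rw [hnμ]
      field_simp
      ring
  case val =>
    simp only [Finset.sum_range_succ, Finset.sum_range_zero]
    push_cast
    ring

open scoped Classical in
/-- **Theorem B (universal optimality of the cross-polytope, Cohn–Kumar Thm. 1.2, every `n ≥ 3`).**
For every potential `a` with `a(s) = Σ_k c_k (1+s)^k`, `c_k ≥ 0`, on `[-1,1)` (≡ absolutely
monotonic on `[-1,1)` by Bernstein's theorem), every `2n`-point configuration of unit vectors in `ℝⁿ`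
has `Σ_{x ≠ y} a(⟨x,y⟩) ≥ 2n (a(-1) + (2n - 2) a(0))`, the `a`-energy of the regular cross-polytope.
[cite: CohnKumar2006, Theorem 1.2] -/
theorem universally_optimal {n : ℕ} (hn : 3 ≤ n) (a : ℝ → ℝ) (c : ℕ → ℝ) (hc : ∀ k, 0 ≤ c k)
    (ha : ∀ s : ℝ, -1 ≤ s → s < 1 → HasSum (fun k => c k * (1 + s) ^ k) (a s))
    (C : Finset (EuclideanSpace ℝ (Fin n))) (h1 : ∀ x ∈ C, ‖x‖ = 1) (hN : C.card = 2 * n) :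
    (2 * n : ℝ) * (a (-1) + (2 * n - 2) * a 0) ≤
      ∑ x ∈ C, ∑ y ∈ C.erase x, a (inner ℝ x y) := by
  have key := NewtonCert.energy_ge_hasSum_of_pow (n := n) (2 * n) 2
    (fun i : ℕ => match i with | 0 => (-1 : ℝ) | 1 => 0 | _ => 0)
    (fun i : ℕ => match i with | 0 => (1 : ℝ) | 1 => 2 * n - 2 | _ => 0)
    (fun i hi => by interval_cases i <;> norm_num) C h1
    (fun k => by
      have h := ckPow_energy_ge hn k C h1 hN
      simp only [Finset.sum_range_succ, Finset.sum_range_zero] at h ⊢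
      push_cast at h ⊢
      linarith)
    a c hc ha
  simp only [Finset.sum_range_succ, Finset.sum_range_zero] at key
  push_cast at key
  linarith

end UniversalCrossPolytope

end Summit.Ventures.PackingBounds.Energy

end
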